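import Summits.BirchSwinnertonDyer.BirchSwinnertonDyer.Theorems.BiquadraticEisensteinDescentHeegnerTwistCouplingInSupplySqrtTwoCorner
import Literature.NumberTheory.EllipticCurves.SqrtTwoTwistBrewerTheorem
import HarnessLib

set_option linter.dupNamespace false -- `Summit.BirchSwinnertonDyer.BirchSwinnertonDyer.Theorems.…` (summit = sub)
set_option autoImplicit false

/-!
# The `j = 8000` corner without the Deuring–Hecke binder: `L(B_{−m}, 1) ≠ 0` on CELL-5 and the `B_p` corner T_A modulo Burungale–Tian ONLY

Route `BiquadraticEisensteinDescent` (cell `pub/bsd-wall`, width seat `bsd-wall-cm-bed-w3` g13; `--supports` 21381, helper). Sequel of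
`…SqrtTwoCorner` (w1 g10).  The binder `hH : hasEntireLFunction_of_j_mem_maximalCMJInvariants` (Deuring–Hecke continuation for the nine
CM `j`-invariants) of `L_one_ne_zero_B_neg`, `L_one_ne_zero_B_neg_of_selmerCorank` and `cruxOnBpCorner_of_two_facts` is used there only
as `hH W hj` with `j(W) = 8000`; that instance is now a THEOREM of the tree,
`Literature.NumberTheory.EllipticCurves.SqrtTwoTwist.hasEntireLFunction_of_j_eq_8000_holds` (the `ℤ[√−2]` theta dictionary of the
`SqrtTwoTwist*` files with Brewer's sign law proved elementarily, `SqrtTwoTwistBrewerTheorem`).  This file restates the three results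
WITHOUT `hH` (same proofs, the binder replaced by the theorem):

* `L_one_ne_zero_B_neg'` — `r_an(B_{−m}) = 0 ∧ L(B_{−m}, 1) ≠ 0` on CELL-5, modulo Burungale–Tian (`hBT`) only;
* `L_one_ne_zero_B_neg_of_selmerCorank'` — the generic corank form, modulo `hBT` only;
* ★★ `cruxOnBpCorner_of_burungaleTian` — corner T_A (`p ≡ 5 (mod 8)`, `p ≡ ±2 (mod 5)`, `W = B_p`): the CONCLUSION of crux 21381
  for `W = B_p` modulo the ONE named fact `hBT` (Burungale–Tian's rank-zero `2`-converse for CM curves).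

HONEST FRAMING: exactly the content of `…SqrtTwoCorner` with one named fact fewer; the crux (all CM `W` of analytic rank one; residual C⁺)
is untouched; BSD is not proved by any of this.  THEOREMS ONLY; supports stmt-BirchSwinnertonDyer-21381.
-/

noncomputable section

open scoped Classical NumberField

namespace Summit.BirchSwinnertonDyer.BirchSwinnertonDyer.Theorems.BiquadraticEisensteinDescentHeegnerTwistCouplingInSupplySqrtTwoCornerDeuringHeckeFree

open _root_.WeierstrassCurve Literature.NumberTheory.EllipticCurves
open IsDedekindDomain Rat.HeightOneSpectrum
open Summit.BirchSwinnertonDyer.BirchSwinnertonDyer.Theorems.BiquadraticEisensteinDescentHeegnerTwistCouplingInSupplySqrtTwoCell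
open Summit.BirchSwinnertonDyer.BirchSwinnertonDyer.Theorems.BiquadraticEisensteinDescentHeegnerTwistCouplingInSupplySqrtTwoPin
open Summit.BirchSwinnertonDyer.BirchSwinnertonDyer.Theorems.BiquadraticEisensteinDescentHeegnerTwistCouplingInSupplySqrtTwoCorner

/-! ## §1 `L(B_{−m}, 1) ≠ 0` on CELL-5, modulo Burungale–Tian only -/

section LValue

variable {m : ℤ}

/-- ★ **CELL-5, `L`-form, Deuring–Hecke-free**: `r_an(B_{−m}) = 0` and `L(B_{−m}, 1) ≠ 0` for `m > 0` square-free with every prime factor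
`≡ ±3 (mod 8)`, modulo Burungale–Tian only (`hBT`, at the prime `2`, on `corank = 0` from `…SqrtTwoCell.selmerCorank_two_B_eq_zero`);
the continuation of `L(B_{−m}, s)` needed to read `r_an = 0` as `L(1) ≠ 0` is the tree theorem
`SqrtTwoTwist.hasEntireLFunction_of_j_eq_8000_holds`. [cite: BurungaleTian2026, Thm. 1.1] [cite: Brewer1961, Theorem 2] -/
theorem L_one_ne_zero_B_neg' (hBT : burungaleTian_analyticRank_eq_zero_of_selmerCorank_eq_zero_of_hasCM)
    (hm0 : 0 < m) (hm : Squarefree m) (hm8 : ∀ r : ℕ, r.Prime → (r : ℤ) ∣ m → r % 8 = 3 ∨ r % 8 = 5)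
    [hE : (⟨0, -4 * (m : ℚ), 0, 2 * (m : ℚ) ^ 2, 0⟩ : WeierstrassCurve ℚ).IsElliptic] :
    (⟨0, -4 * (m : ℚ), 0, 2 * (m : ℚ) ^ 2, 0⟩ : WeierstrassCurve ℚ).analyticRank = 0 ∧
      (⟨0, -4 * (m : ℚ), 0, 2 * (m : ℚ) ^ 2, 0⟩ : WeierstrassCurve ℚ).entireLFunction 1 ≠ 0 := by
  haveI : Fact (Nat.Prime 2) := ⟨Nat.prime_two⟩
  obtain ⟨hj, hCM⟩ := j_and_hasCM_B_neg hm0.ne'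
  have h0 := hBT _ hCM 2 (selmerCorank_two_B_eq_zero hm0 hm hm8)
  exact ⟨h0, (analyticRank_eq_zero_iff_holds (W := (⟨0, -4 * (m : ℚ), 0, 2 * (m : ℚ) ^ 2, 0⟩ : WeierstrassCurve ℚ))
    (SqrtTwoTwist.hasEntireLFunction_of_j_eq_8000_holds _ hj)).1 h0⟩

/-- ★ **Generic `L`-form from the corank, Deuring–Hecke-free**: for any `m ≠ 0`, `corank_{ℤ₂} Sel_{2^∞}(B_{−m}) = 0` gives
`r_an(B_{−m}) = 0` and `L(B_{−m}, 1) ≠ 0`, modulo Burungale–Tian only. [cite: BurungaleTian2026, Thm. 1.1] [cite: Brewer1961, Theorem 2] -/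
theorem L_one_ne_zero_B_neg_of_selmerCorank' (hBT : burungaleTian_analyticRank_eq_zero_of_selmerCorank_eq_zero_of_hasCM)
    (hm : m ≠ 0) [hE : (⟨0, -4 * (m : ℚ), 0, 2 * (m : ℚ) ^ 2, 0⟩ : WeierstrassCurve ℚ).IsElliptic]
    (hcor : (⟨0, -4 * (m : ℚ), 0, 2 * (m : ℚ) ^ 2, 0⟩ : WeierstrassCurve ℚ).selmerCorank 2 = 0) :
    (⟨0, -4 * (m : ℚ), 0, 2 * (m : ℚ) ^ 2, 0⟩ : WeierstrassCurve ℚ).analyticRank = 0 ∧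
      (⟨0, -4 * (m : ℚ), 0, 2 * (m : ℚ) ^ 2, 0⟩ : WeierstrassCurve ℚ).entireLFunction 1 ≠ 0 := by
  haveI : Fact (Nat.Prime 2) := ⟨Nat.prime_two⟩
  obtain ⟨hj, hCM⟩ := j_and_hasCM_B_neg hm
  have h0 := hBT _ hCM 2 hcor
  exact ⟨h0, (analyticRank_eq_zero_iff_holds (W := (⟨0, -4 * (m : ℚ), 0, 2 * (m : ℚ) ^ 2, 0⟩ : WeierstrassCurve ℚ))
    (SqrtTwoTwist.hasEntireLFunction_of_j_eq_8000_holds _ hj)).1 h0⟩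

end LValue

/-! ## §2 Corner T_A modulo Burungale–Tian only -/

section Corner

/-- ★★ **CORNER T_A of card `sqrt2-isogeny-heegner-pin`, ONE NAMED FACT.** For every prime `p ≡ 5 (mod 8)` with `p ≡ ±2 (mod 5)` and
`W = B_p : y² = x³ + 4p x² + 2p² x` (`j = 8000`, CM by `ℤ[√−2]`): there is an imaginary quadratic field `K′` (`= ℚ(√−5ℓ)`, `ℓ` the pin
prime) with `4 < |d_{K′}|`, Heegner for `N(B_p)`, `L(B_p^{(d_{K′})}, 1) ≠ 0`, `h(K′) < p` and `p ∤ h(K′)` — the CONCLUSION of crux 21381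
for `W = B_p`, modulo Burungale–Tian (`hBT`) ONLY: the proof of `…SqrtTwoCorner.cruxOnBpCorner_of_two_facts` with the Deuring–Hecke binder
replaced by the tree theorem `SqrtTwoTwist.hasEntireLFunction_of_j_eq_8000_holds` (via `L_one_ne_zero_B_neg'`).
[cite: BurungaleTian2026, Thm. 1.1] [cite: SilvermanAEC2009, Prop. X.4.9 and Thm. X.4.2(a)] [cite: Oesterle1988Gauss, II §3 Proposition p. 57 (27)] -/
theorem cruxOnBpCorner_of_burungaleTian (hBT : burungaleTian_analyticRank_eq_zero_of_selmerCorank_eq_zero_of_hasCM) :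
    ∀ (p : ℕ) [Fact p.Prime] [(⟨0, 4 * (p : ℚ), 0, 2 * (p : ℚ) ^ 2, 0⟩ : WeierstrassCurve ℚ).IsElliptic]
      [(⟨0, 4 * (p : ℚ), 0, 2 * (p : ℚ) ^ 2, 0⟩ : WeierstrassCurve ℚ).IsGloballyMinimal]
      [NeZero ((⟨0, 4 * (p : ℚ), 0, 2 * (p : ℚ) ^ 2, 0⟩ : WeierstrassCurve ℚ).conductorNorm ℤ)],
      p % 8 = 5 → (p % 5 = 2 ∨ p % 5 = 3) →
      ∃ (K : Type) (_ : Field K) (_ : NumberField K),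
        IsImaginaryQuadratic K ∧ 4 < (NumberField.discr K).natAbs ∧
        SatisfiesHeegnerHypothesis ((⟨0, 4 * (p : ℚ), 0, 2 * (p : ℚ) ^ 2, 0⟩ : WeierstrassCurve ℚ).conductorNorm ℤ) K ∧
        ((⟨0, 4 * (p : ℚ), 0, 2 * (p : ℚ) ^ 2, 0⟩ : WeierstrassCurve ℚ).quadraticTwist (NumberField.discr K : ℚ)).entireLFunction 1 ≠ 0 ∧
        NumberField.classNumber K < p ∧ ¬ p ∣ NumberField.classNumber K := by
  intro p hpF _ _ _ hp8 hp5
  have hp : p.Prime := hpF.out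
  obtain ⟨ℓ, K, iF, iN, hℓ, hℓp, hℓ8, -, -, -, hK, hdK, hH', hcl, hsq, hfac⟩ :=
    exists_sqrtTwoPin_witnessField hp hp8 hp5 (N := (⟨0, 4 * (p : ℚ), 0, 2 * (p : ℚ) ^ 2, 0⟩ : WeierstrassCurve ℚ).conductorNorm ℤ)
      (fun r hr hrN => eq_two_or_eq_of_prime_dvd_conductorNorm_B hp hr hrN)
  refine ⟨K, iF, iN, hK, ?_, hH', ?_, hcl, fun hdvd =>
    absurd (Nat.le_of_dvd (NumberField.classNumber_pos K) hdvd) (not_le.mpr hcl)⟩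
  · rw [hdK, Int.natAbs_neg, Int.natAbs_natCast]
    have := hℓ.two_le
    omega
  · rw [hdK, quadraticTwist_B_neg_five_mul]
    have hm0 : (0 : ℤ) < ((5 * p * ℓ : ℕ) : ℤ) := by
      have := hp.pos
      have := hℓ.pos
      positivity
    have hmsq : Squarefree (((5 * p * ℓ : ℕ) : ℤ)) := Int.squarefree_natCast.mpr hsq
    have hm8 : ∀ r : ℕ, r.Prime → (r : ℤ) ∣ ((5 * p * ℓ : ℕ) : ℤ) → r % 8 = 3 ∨ r % 8 = 5 :=
      fun r hr hrd => hfac r hr (by exact_mod_cast hrd)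
    haveI := isElliptic_B hm0.ne'
    exact (L_one_ne_zero_B_neg' hBT hm0 hmsq hm8).2

end Corner

end Summit.BirchSwinnertonDyer.BirchSwinnertonDyer.Theorems.BiquadraticEisensteinDescentHeegnerTwistCouplingInSupplySqrtTwoCornerDeuringHeckeFree

end
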